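import Summits.Ventures.HodgeRepro2.T5BergmanOrbitTotal

/-!
# Irreducibility of the weighted Bergman model, in the subspace formulation

`T5BergmanOrbitTotal` says that the orbit `π_k(G) h` of every non-zero `h ∈ A_k` is total. The usual
"closed invariant subspace" formulation of irreducibility is stated here WITHOUT a Hilbert-space type
on the tree: a set `W` of holomorphic vectors of `A_k` is `π_k(G)`-STABLE (with `f ∈ W` every `π_k(g) f`
agrees on the disc with an element of `W`), `h ⟂ W` means `⟨f, h⟩_k = 0` for all `f ∈ W`, and the theorem is

* `eq_zero_of_orthogonalTo_of_isInvariant`: if `W` is stable and contains a vector that is not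
  identically zero on the disc, every `h ∈ A_k` orthogonal to `W` vanishes on the disc — the
  orthogonal complement of a non-zero stable subspace is `0`;
* `isInvariant_dichotomy`: a stable `W` is either identically zero on the disc or has trivial
  orthogonal complement in `A_k`.

(The passage from «`W⊥ = 0`» to «`W` is dense in `A_k`» is the projection theorem of the completion —
`A_k` is complete by `T5BergmanComplete` — and is not restated here.)

Blind lane: Mathlib + the HodgeRepro2 prefix only; no sorry; axioms ⊆ {propext, Classical.choice,
Quot.sound}.
-/

namespace Summit.Ventures.HodgeRepro2.T5BergmanIrreducible

open MeasureTheory Metric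
open T5SU11Unimodular T5BergmanCoefficient T5BergmanPairing T5BergmanUnitary T5BergmanOrbitTotal
open scoped Real

variable [MeasurableSpace Circle] [BorelSpace Circle]

/-- **The orthogonal complement of a non-zero stable subspace is zero**: if `W ⊆ A_k` (holomorphic
vectors) is `π_k(G)`-stable and contains `f₀` not identically zero on the disc, then every holomorphic
`h ∈ A_k` orthogonal to `W` vanishes on the disc. -/
theorem eq_zero_of_orthogonalTo_of_isInvariant (k : ℕ) (hk : 2 ≤ k) (W : Set (ℂ → ℂ))
    (hW : ∀ f ∈ W, ∀ g : SU11, ∃ f' ∈ W, ∀ z ∈ ball (0 : ℂ) 1, act k g f z = f' z)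
    (f₀ : ℂ → ℂ) (hf₀W : f₀ ∈ W) (hf₀ : DifferentiableOn ℂ f₀ (ball 0 1))
    (hf₀int : IntegrableOn (fun w => ‖f₀ w‖ ^ 2 * (1 - ‖w‖ ^ 2) ^ (k - 2)) (ball (0 : ℂ) 1))
    (hf₀ne : ∃ z ∈ ball (0 : ℂ) 1, f₀ z ≠ 0)
    (h : ℂ → ℂ) (hh : DifferentiableOn ℂ h (ball 0 1))
    (hhint : IntegrableOn (fun w => ‖h w‖ ^ 2 * (1 - ‖w‖ ^ 2) ^ (k - 2)) (ball (0 : ℂ) 1))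
    (hperp : ∀ f ∈ W, pairing k f h = 0) :
    ∀ z ∈ ball (0 : ℂ) 1, h z = 0 := by
  refine orbit_total' k hk f₀ h hf₀ hf₀int hh hhint hf₀ne fun g => ?_
  obtain ⟨f', hf'W, hf'⟩ := hW f₀ hf₀W g
  rw [pairing_congr hf' (fun _ _ => rfl)]
  exact hperp f' hf'W

/-- **Irreducibility, subspace form**: a `π_k(G)`-stable set `W` of holomorphic vectors of `A_k` is either
identically zero on the disc, or its orthogonal complement in `A_k` (holomorphic vectors) is zero. -/
theorem isInvariant_dichotomy (k : ℕ) (hk : 2 ≤ k) (W : Set (ℂ → ℂ))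
    (hW : ∀ f ∈ W, ∀ g : SU11, ∃ f' ∈ W, ∀ z ∈ ball (0 : ℂ) 1, act k g f z = f' z)
    (hWhol : ∀ f ∈ W, DifferentiableOn ℂ f (ball 0 1))
    (hWint : ∀ f ∈ W, IntegrableOn (fun w => ‖f w‖ ^ 2 * (1 - ‖w‖ ^ 2) ^ (k - 2)) (ball (0 : ℂ) 1)) :
    (∀ f ∈ W, ∀ z ∈ ball (0 : ℂ) 1, f z = 0) ∨
      ∀ h : ℂ → ℂ, DifferentiableOn ℂ h (ball 0 1) →
        IntegrableOn (fun w => ‖h w‖ ^ 2 * (1 - ‖w‖ ^ 2) ^ (k - 2)) (ball (0 : ℂ) 1) →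
        (∀ f ∈ W, pairing k f h = 0) → ∀ z ∈ ball (0 : ℂ) 1, h z = 0 := by
  by_cases hz : ∀ f ∈ W, ∀ z ∈ ball (0 : ℂ) 1, f z = 0
  · exact Or.inl hz
  · right
    intro h hh hhint hperp
    have hex : ∃ f₀ ∈ W, ∃ z ∈ ball (0 : ℂ) 1, f₀ z ≠ 0 := by
      by_contra hcon
      apply hz
      intro f hf z hzb
      by_contra hfz
      exact hcon ⟨f, hf, z, hzb, hfz⟩
    obtain ⟨f₀, hf₀W, hf₀ne⟩ := hex
    exact eq_zero_of_orthogonalTo_of_isInvariant k hk W hW f₀ hf₀W (hWhol f₀ hf₀W) (hWint f₀ hf₀W)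
      hf₀ne h hh hhint hperp

omit [MeasurableSpace Circle] [BorelSpace Circle] in
/-- The orbit of a single vector is stable (the set `{π_k(g) f : g ∈ G}`, up to equality on the disc). -/
theorem isInvariant_orbit (k : ℕ) (f : ℂ → ℂ) :
    ∀ f₁ ∈ {f' | ∃ g : SU11, f' = act k g f}, ∀ g : SU11,
      ∃ f' ∈ {f' | ∃ g : SU11, f' = act k g f}, ∀ z ∈ ball (0 : ℂ) 1, act k g f₁ z = f' z := by
  rintro _ ⟨g₀, rfl⟩ g
  refine ⟨act k (g * g₀) f, ⟨g * g₀, rfl⟩, fun z hz => ?_⟩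
  exact (act_mul k g g₀ f hz).symm

/-- **Every non-zero vector is cyclic (orthogonal-complement form)**: if `f` is holomorphic in `A_k` and
not identically zero on the disc, every holomorphic `h ∈ A_k` orthogonal to the orbit `π_k(G) f` vanishes
on the disc. -/
theorem eq_zero_of_orthogonalTo_orbit (k : ℕ) (hk : 2 ≤ k) (f : ℂ → ℂ)
    (hf : DifferentiableOn ℂ f (ball 0 1))
    (hfint : IntegrableOn (fun w => ‖f w‖ ^ 2 * (1 - ‖w‖ ^ 2) ^ (k - 2)) (ball (0 : ℂ) 1))
    (hfne : ∃ z ∈ ball (0 : ℂ) 1, f z ≠ 0) (h : ℂ → ℂ) (hh : DifferentiableOn ℂ h (ball 0 1))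
    (hhint : IntegrableOn (fun w => ‖h w‖ ^ 2 * (1 - ‖w‖ ^ 2) ^ (k - 2)) (ball (0 : ℂ) 1))
    (hperp : ∀ f' ∈ {f' | ∃ g : SU11, f' = act k g f}, pairing k f' h = 0) :
    ∀ z ∈ ball (0 : ℂ) 1, h z = 0 :=
  eq_zero_of_orthogonalTo_of_isInvariant k hk _ (isInvariant_orbit k f) f ⟨1, by
    funext z
    exact (act_one k f z).symm⟩ hf hfint hfne h hh hhint hperp

end Summit.Ventures.HodgeRepro2.T5BergmanIrreducible
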